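import Summits.MatrixMultiplication.OmegaCensus.SmallFormats.InvertiblePointNearFrame
import Summits.MatrixMultiplication.OmegaCensus.SmallFormats.InvertiblePointMultiColumnClause
import HarnessLib

/-!
# ω-census family (a): the multi-column clause at a NEAR point — core lemma

Cell `pub-omega` (unit `pub-omega-tensor`, gen 36), topic `Summits/MatrixMultiplication/OmegaCensus` (sub-folder
`SmallFormats`). Framing (verbatim): lottery ticket; floor = certified bounds/negative ranges. HONEST FRAMING: elementary linear
algebra over an arbitrary field (new, not a port). At a near `X₀ = 1` (exactly `2n + 1` nonvanishing X-forms) of a computation of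
`⟨2,2,n⟩`: `rel_cross` (the outputs `W_s`, `s ∈ O`, satisfy exactly one relation) and the CORE LEMMA `near_columns_core`: there
are no pairwise independent `x_i ∈ k²` (at least two) with nonzero `w_i ∈ kⁿ`, `x_i ⊗ w_i` killed by every vanishing term's
`g_t`, and a relation `Σ a_i w_i = 0` with all `a_i ≠ 0`. The proof (steps (1)–(5)) is spelled out in the docstring of
`InvertiblePointNearColumnClause`, which turns the lemma into the clause `dim(K₀ ⊓ k²⊗F) ≤ dim F`. Nothing here is a rank bound
and nothing is a bound on `ω`.
-/

namespace Summit.MatrixMultiplication.OmegaCensus.SmallFormats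

open Module Matrix Literature.Computability.AlgebraicComplexity

namespace NearDeltaLaw

variable {k : Type*} [Field k] {n : ℕ} {ι : Type*} [Fintype ι] [DecidableEq ι]

/-! ## Two-dimensional preliminaries -/

/-- The vector `x^⊥ = (x₁, −x₀)` is orthogonal to `x` (the tree's no-`def` convention: `x^⊥` is spelled `![x 1, -x 0]`). -/
theorem perp_dotProduct (x : Fin 2 → k) : ![x 1, -x 0] ⬝ᵥ x = 0 := by
  simp only [dotProduct, Fin.sum_univ_two, Matrix.cons_val_zero, Matrix.cons_val_one]; ring

/-- `x^⊥ ≠ 0` for `x ≠ 0`. -/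
theorem perp_ne_zero {x : Fin 2 → k} (hx : x ≠ 0) : ![x 1, -x 0] ≠ 0 := by
  intro h
  have h0 : x 1 = 0 := by
    have := congr_fun h 0
    simpa using this
  have h1 : x 0 = 0 := by
    have := congr_fun h 1
    simpa using this
  exact hx (by funext i; fin_cases i <;> simp [h0, h1])

/-- `y ⊗ x^⊥` annihilates `x`. -/
theorem vecMulVec_perp_mulVec (y x : Fin 2 → k) : vecMulVec y ![x 1, -x 0] *ᵥ x = 0 := by
  rw [vecMulVec_mulVec, perp_dotProduct, MulOpposite.op_zero, zero_smul]

/-- A `2 × 2` matrix annihilating two independent vectors is zero. -/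
theorem eq_zero_of_mulVec_eq_zero₂ {x x' : Fin 2 → k} (hd : x 0 * x' 1 - x 1 * x' 0 ≠ 0)
    {X : Matrix (Fin 2) (Fin 2) k} (h : X *ᵥ x = 0) (h' : X *ᵥ x' = 0) : X = 0 := by
  ext r c
  have h1 : X r 0 * x 0 + X r 1 * x 1 = 0 := by
    have := congr_fun h r
    simpa [mulVec, dotProduct, Fin.sum_univ_two] using this
  have h2 : X r 0 * x' 0 + X r 1 * x' 1 = 0 := by
    have := congr_fun h' r
    simpa [mulVec, dotProduct, Fin.sum_univ_two] using this
  have ha : X r 0 * (x 0 * x' 1 - x 1 * x' 0) = 0 := by linear_combination (x' 1) * h1 - (x 1) * h2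
  have hb : X r 1 * (x 0 * x' 1 - x 1 * x' 0) = 0 := by linear_combination (x 0) * h2 - (x' 0) * h1
  rw [Matrix.zero_apply]
  fin_cases c
  · exact (mul_eq_zero.mp ha).resolve_right hd
  · exact (mul_eq_zero.mp hb).resolve_right hd

/-- `y ⊗ 0 = 0` (rectangular version). -/
theorem vecMulVec_zero' (y : Fin 2 → k) : vecMulVec y (0 : Fin n → k) = 0 := by
  ext i j; simp [vecMulVec_apply]

/-- `a ⊗ b = 0` forces `a = 0` or `b = 0` (rectangular version). -/
theorem vecMulVec_eq_zero' {a : Fin 2 → k} {b : Fin n → k} (h : vecMulVec a b = 0) : a = 0 ∨ b = 0 := by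
  by_contra hc
  push Not at hc
  obtain ⟨i, ha⟩ := Function.ne_iff.mp hc.1
  obtain ⟨j, hb⟩ := Function.ne_iff.mp hc.2
  exact mul_ne_zero ha hb (by simpa [vecMulVec_apply] using congr_fun (congr_fun h i) j)

/-! ## Uniqueness of the output relation at a near point -/

omit [DecidableEq ι] in
/-- **One relation.** At a near `X₀ = 1` (`|O| = 2n + 1`) with output relation `ρ ≠ 0` (on `O`), every relation
`Σ_{s∈O} b_s W_s = 0` is proportional to `ρ`: `b_s ρ_{s'} = b_{s'} ρ_s`. -/
theorem rel_cross (β : BilinComp (mulBilin k 2 2 n) ι) (O : Finset ι) (hO : ∀ i, i ∉ O → β.f i 1 = 0)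
    (hcard : O.card = 2 * n + 1) {ρ : ι → k} (hrel : ∑ j ∈ O, ρ j • β.w j = 0) (hρ : ∃ s ∈ O, ρ s ≠ 0)
    {b : ι → k} (hb : ∑ j ∈ O, b j • β.w j = 0) : ∀ s ∈ O, ∀ s' ∈ O, b s * ρ s' = b s' * ρ s := by
  classical
  let Φ : (O → k) →ₗ[k] Matrix (Fin 2) (Fin n) k := Fintype.linearCombination k (fun j : O => β.w j)
  have hΦapply : ∀ a : O → k, Φ a = ∑ j : O, a j • β.w (j : ι) := fun a => Fintype.linearCombination_apply _ _ a
  have hsurj : LinearMap.range Φ = ⊤ := by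
    rw [Fintype.range_linearCombination]
    exact top_le_iff.mp (top_le_span_w_off β 1 isUnit_det_one_fin O hO)
  have hker : finrank k (LinearMap.ker Φ) = 1 := by
    have h1 := LinearMap.finrank_range_add_finrank_ker Φ
    rw [hsurj, finrank_top, finrank_matrix_fin, finrank_fintype_fun_eq_card, Fintype.card_coe, hcard] at h1
    omega
  have memker : ∀ c : ι → k, ∑ j ∈ O, c j • β.w j = 0 → (fun j : O => c j) ∈ LinearMap.ker Φ := by
    intro c hc
    rw [LinearMap.mem_ker, hΦapply]
    have h : ∑ j : O, (fun j : O => c (j : ι)) j • β.w (j : ι) = ∑ j ∈ O, c j • β.w j :=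
      Finset.sum_coe_sort O (fun j => c j • β.w j)
    rw [h, hc]
  obtain ⟨s₀, hs₀, hρ₀⟩ := hρ
  have hρO : (⟨fun j : O => ρ j, memker ρ hrel⟩ : LinearMap.ker Φ) ≠ 0 := by
    intro h
    have h' := congrArg (fun v : LinearMap.ker Φ => (v : O → k) ⟨s₀, hs₀⟩) h
    simp only [ZeroMemClass.coe_zero, Pi.zero_apply] at h'
    exact hρ₀ h'
  obtain ⟨c, hc⟩ := (finrank_eq_one_iff_of_nonzero' _ hρO).mp hker ⟨fun j : O => b j, memker b hb⟩
  intro s hs s' hs'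
  have h1 := congrArg (fun v : LinearMap.ker Φ => (v : O → k) ⟨s, hs⟩) hc
  have h2 := congrArg (fun v : LinearMap.ker Φ => (v : O → k) ⟨s', hs'⟩) hc
  simp only [SetLike.val_smul, Pi.smul_apply, smul_eq_mul] at h1 h2
  rw [← h1, ← h2]
  ring

/-! ## The core: no supported relation among rank-one kernel elements in distinct row directions -/

/-- **Core lemma.** At a near `X₀ = 1`: there are no pairwise independent `x_i ∈ k²` (at least two) and nonzero `w_i ∈ kⁿ` with
`x_i ⊗ w_i ∈ K₀` (killed by every `g_t`, `t ∉ O`) admitting a relation `Σ a_i w_i = 0` with all `a_i ≠ 0`. -/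
theorem near_columns_core (β : BilinComp (mulBilin k 2 2 n) ι) (O : Finset ι)
    (hO : ∀ i, i ∉ O → β.f i 1 = 0) (hO' : ∀ i ∈ O, β.f i 1 ≠ 0) (hcard : O.card = 2 * n + 1)
    {κ : Type*} [Fintype κ] [DecidableEq κ] (xs : κ → (Fin 2 → k))
    (hxs : ∀ i j, i ≠ j → xs i 0 * xs j 1 - xs i 1 * xs j 0 ≠ 0)
    (w : κ → (Fin n → k)) (hw : ∀ i, w i ≠ 0)
    (hK : ∀ i t, t ∉ O → β.g t (vecMulVec (xs i) (w i)) = 0)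
    (a : κ → k) (ha : ∀ i, a i ≠ 0) (hrel : ∑ i, a i • w i = 0) {i₀ i₁ : κ} (hne : i₀ ≠ i₁) : False := by
  classical
  -- another index, and `x_i ≠ 0`
  have other : ∀ i : κ, ∃ j, j ≠ i := fun i => by
    by_cases h : i = i₀
    · exact ⟨i₁, by rw [h]; exact hne.symm⟩
    · exact ⟨i₀, Ne.symm h⟩
  have hx0 : ∀ i, xs i ≠ 0 := by
    intro i h
    obtain ⟨j, hj⟩ := other i
    exact hxs i j hj.symm (by rw [h]; simp)
  -- the near frame
  obtain ⟨ρ, σ, hρne, hrelW, hM, -⟩ := exists_nearFrame β O hO hcard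
  set Y : κ → Matrix (Fin 2) (Fin n) k := fun i => vecMulVec (xs i) (w i) with hY
  have hYK : ∀ i t, t ∉ O → β.g t (Y i) = 0 := hK
  -- Brent on `K₀`
  have hXY : ∀ (i) (X : Matrix (Fin 2) (Fin 2) k), X * Y i = ∑ s ∈ O, (β.f s X * β.g s (Y i)) • β.w s := by
    intro i X
    have hB := β.map_eq_sum X (Y i)
    rw [mulBilin_apply] at hB
    rw [hB, ← Finset.sum_subset (Finset.subset_univ O)]
    intro l _ hl
    rw [hYK i l hl, mul_zero, zero_smul]
  have hXYv : ∀ (i) (X : Matrix (Fin 2) (Fin 2) k), X * Y i = vecMulVec (X *ᵥ xs i) (w i) :=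
    fun i X => mul_vecMulVec X (xs i) (w i)
  -- near transport
  have htr : ∀ i, ∀ s ∈ O, ∀ X : Matrix (Fin 2) (Fin 2) k,
      β.f s 1 * β.g s (X * Y i) = β.f s X * β.g s (Y i) + ρ s * ∑ s' ∈ O, σ s' * (β.f s' X * β.g s' (Y i)) :=
    fun i s hs X => near_transport β O hM (hYK i) hs X
  -- uniqueness of relations
  have hF3 : ∀ b : ι → k, ∑ j ∈ O, b j • β.w j = 0 → ∀ s ∈ O, ∀ s' ∈ O, b s * ρ s' = b s' * ρ s :=
    fun b hb => rel_cross β O hO hcard hrelW hρne hb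
  -- (2) annihilators give relations
  have hvan : ∀ (i) (X : Matrix (Fin 2) (Fin 2) k), X *ᵥ xs i = 0 →
      ∀ s ∈ O, ∀ s' ∈ O, (β.f s X * β.g s (Y i)) * ρ s' = (β.f s' X * β.g s' (Y i)) * ρ s := by
    intro i X hX
    refine hF3 (fun s => β.f s X * β.g s (Y i)) ?_
    rw [← hXY, hXYv, hX, zero_vecMulVec]
  -- lifting a vector: a matrix `X` with `X x_i = y`
  have hlift : ∀ (i) (y : Fin 2 → k), ∃ X : Matrix (Fin 2) (Fin 2) k, X *ᵥ xs i = y := by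
    intro i y
    obtain ⟨l, hl⟩ := Function.ne_iff.mp (hx0 i)
    refine ⟨vecMulVec y (Pi.single l (xs i l)⁻¹), ?_⟩
    rw [vecMulVec_mulVec, single_dotProduct, inv_mul_cancel₀ hl, MulOpposite.op_one, one_smul]
  -- (1) forms off the support of `ρ` kill every `Y i`
  have hS1 : ∀ s ∈ O, ρ s = 0 → ∀ i, β.g s (Y i) = 0 := by
    intro s hs hρs
    have htr0 : ∀ (i) (X : Matrix (Fin 2) (Fin 2) k), β.f s 1 * β.g s (X * Y i) = β.f s X * β.g s (Y i) := by
      intro i X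
      rw [htr i s hs X, hρs, zero_mul, add_zero]
    have hfann : ∀ j, β.g s (Y j) ≠ 0 → ∀ X : Matrix (Fin 2) (Fin 2) k, X *ᵥ xs j = 0 → β.f s X = 0 := by
      intro j hj X hX
      have h := htr0 j X
      rw [hXYv, hX, zero_vecMulVec, map_zero, mul_zero] at h
      exact (mul_eq_zero.mp h.symm).resolve_right hj
    have hgpl : ∀ j, β.g s (Y j) = 0 → ∀ y : Fin 2 → k, β.g s (vecMulVec y (w j)) = 0 := by
      intro j hj y
      obtain ⟨X, hXx⟩ := hlift j y
      have h := htr0 j X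
      rw [hXYv, hXx, hj, mul_zero] at h
      exact (mul_eq_zero.mp h).resolve_left (hO' s hs)
    by_contra hcon
    push Not at hcon
    obtain ⟨i, hi⟩ := hcon
    have hj0 : ∀ j, j ≠ i → β.g s (Y j) = 0 := by
      intro j hji
      by_contra hj
      exact not_f_vanish_two_annihilators (β.f s) (hO' s hs) (hxs i j (Ne.symm hji)) (hfann i hi) (hfann j hj)
    -- the relation tensored with `x_i`
    have hsum : ∑ j, a j • vecMulVec (xs i) (w j) = 0 := by
      have h : ∑ j, a j • vecMulVec (xs i) (w j) = vecMulVec (xs i) (∑ j, a j • w j) := by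
        rw [← DeltaLaw.vecMulVecRight_apply, map_sum]
        refine Finset.sum_congr rfl fun j _ => ?_
        rw [map_smul, DeltaLaw.vecMulVecRight_apply]
      rw [h, hrel]
      exact vecMulVec_zero' _
    have hai : a i * β.g s (Y i) = 0 := by
      have h := congrArg (β.g s) hsum
      rw [map_sum, map_zero, ← Finset.add_sum_erase _ _ (Finset.mem_univ i)] at h
      rw [map_smul, smul_eq_mul] at h
      have hrest : ∑ j ∈ Finset.univ.erase i, β.g s (a j • vecMulVec (xs i) (w j)) = 0 :=
        Finset.sum_eq_zero fun j hj => by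
          rw [map_smul, hgpl j (hj0 j (Finset.ne_of_mem_erase hj)) (xs i), smul_zero]
      rw [hrest, add_zero] at h
      exact h
    exact hi ((mul_eq_zero.mp hai).resolve_left (ha i))
  have hsupp : ∀ i, ∀ s ∈ O, β.g s (Y i) ≠ 0 → ρ s ≠ 0 := fun i s hs h hρs => h (hS1 s hs hρs i)
  -- (3) on the annihilator of `x_i` every product `f_s(X) g_s(Y_i)` vanishes
  have hS3 : ∀ (i) (X : Matrix (Fin 2) (Fin 2) k), X *ᵥ xs i = 0 → ∀ s ∈ O, β.f s X * β.g s (Y i) = 0 := by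
    intro i X₁ hX₁
    by_contra hcon
    push Not at hcon
    obtain ⟨s, hs, hbs⟩ := hcon
    have hgs : β.g s (Y i) ≠ 0 := fun h => hbs (by rw [h, mul_zero])
    have hfs : β.f s X₁ ≠ 0 := fun h => hbs (by rw [h, zero_mul])
    have hρs : ρ s ≠ 0 := hsupp i s hs hgs
    have hall : ∀ s' ∈ O, ρ s' ≠ 0 → β.g s' (Y i) ≠ 0 := by
      intro s' hs' hρs' hg
      have h := hvan i X₁ hX₁ s hs s' hs'
      rw [hg, mul_zero, zero_mul] at h
      exact mul_ne_zero hbs hρs' h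
    -- an annihilator of `x_i` on which `f_s` vanishes is zero
    have key : ∀ X' : Matrix (Fin 2) (Fin 2) k, X' *ᵥ xs i = 0 → β.f s X' = 0 → X' = 0 := by
      intro X' hX' hfX'
      have hz : ∀ s' ∈ O, β.f s' X' * β.g s' (Y i) = 0 := by
        intro s' hs'
        have h := hvan i X' hX' s' hs' s hs
        rw [hfX', zero_mul, zero_mul] at h
        exact (mul_eq_zero.mp h).resolve_right hρs
      have hf0 : ∀ s' ∈ O, ρ s' ≠ 0 → β.f s' X' = 0 := fun s' hs' hρs' =>
        (mul_eq_zero.mp (hz s' hs')).resolve_right (hall s' hs' hρs')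
      have hXYj : ∀ j, X' * Y j = 0 := by
        intro j
        rw [hXY]
        refine Finset.sum_eq_zero fun s' hs' => ?_
        by_cases hρs' : ρ s' = 0
        · rw [hS1 s' hs' hρs' j, mul_zero, zero_smul]
        · rw [hf0 s' hs' hρs', zero_mul, zero_smul]
      obtain ⟨j, hji⟩ := other i
      have hj : X' *ᵥ xs j = 0 := by
        have h := hXYj j
        rw [hXYv] at h
        exact (vecMulVec_eq_zero' h).resolve_right (hw j)
      exact eq_zero_of_mulVec_eq_zero₂ (hxs i j hji.symm) hX' hj
    -- apply `key` to `f_s(X₁)·A_r − f_s(A_r)·X₁`, `A_r = e_r ⊗ perp x_i`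
    set A : Fin 2 → Matrix (Fin 2) (Fin 2) k := fun r => vecMulVec (Pi.single r (1 : k)) ![xs i 1, -xs i 0] with hA
    have hAz : ∀ r, β.f s X₁ • A r - β.f s (A r) • X₁ = 0 := by
      intro r
      refine key _ ?_ ?_
      · rw [Matrix.sub_mulVec, Matrix.smul_mulVec, Matrix.smul_mulVec, hX₁, smul_zero, sub_zero]
        change β.f s X₁ • (vecMulVec (Pi.single r (1 : k)) ![xs i 1, -xs i 0] *ᵥ xs i) = 0
        rw [vecMulVec_perp_mulVec, smul_zero]
      · rw [map_sub, map_smul, map_smul, smul_eq_mul, smul_eq_mul]; ring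
    have hent : ∀ r r' c, β.f s X₁ * A r r' c = β.f s (A r) * X₁ r' c := by
      intro r r' c
      have h := congr_fun (congr_fun (sub_eq_zero.mp (hAz r)) r') c
      simpa [Matrix.smul_apply] using h
    have hAdiag : ∀ r c, A r r c = ![xs i 1, -xs i 0] c := by
      intro r c
      change vecMulVec (Pi.single r (1 : k)) ![xs i 1, -xs i 0] r c = _
      rw [vecMulVec_apply, Pi.single_eq_same, one_mul]
    have hAoff : ∀ r r' c, r' ≠ r → A r r' c = 0 := by
      intro r r' c hr
      change vecMulVec (Pi.single r (1 : k)) ![xs i 1, -xs i 0] r' c = 0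
      rw [vecMulVec_apply, Pi.single_eq_of_ne hr, zero_mul]
    have hfA : ∀ r, β.f s (A r) ≠ 0 := by
      intro r hr
      apply perp_ne_zero (hx0 i)
      funext c
      have h := hent r r c
      rw [hr, zero_mul, hAdiag] at h
      exact (mul_eq_zero.mp h).resolve_left hfs
    have hX0 : X₁ = 0 := by
      ext r' c
      rw [Matrix.zero_apply]
      fin_cases r'
      · have h := hent 1 0 c
        rw [hAoff 1 0 c (by decide), mul_zero] at h
        exact (mul_eq_zero.mp h.symm).resolve_left (hfA 1)
      · have h := hent 0 1 c
        rw [hAoff 0 1 c (by decide), mul_zero] at h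
        exact (mul_eq_zero.mp h.symm).resolve_left (hfA 0)
    exact hfs (by rw [hX0, map_zero])
  -- (4) the supports `P_i = {s : g_s(Y_i) ≠ 0}` are pairwise disjoint
  have hfann : ∀ i, ∀ s ∈ O, β.g s (Y i) ≠ 0 → ∀ X : Matrix (Fin 2) (Fin 2) k, X *ᵥ xs i = 0 → β.f s X = 0 :=
    fun i s hs hg X hX => (mul_eq_zero.mp (hS3 i X hX s hs)).resolve_right hg
  have hdisj : ∀ i j, i ≠ j → ∀ s ∈ O, β.g s (Y i) ≠ 0 → β.g s (Y j) = 0 := by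
    intro i j hij s hs hgi
    by_contra hgj
    exact not_f_vanish_two_annihilators (β.f s) (hO' s hs) (hxs i j hij) (hfann i s hs hgi) (hfann j s hs hgj)
  -- (5) the endgame at `i₀`
  have hex : ∃ s₁ ∈ O, β.g s₁ (Y i₀) ≠ 0 := by
    by_contra hcon
    push Not at hcon
    have h := hXY i₀ 1
    rw [Matrix.one_mul] at h
    have hY0 : Y i₀ = 0 := by
      rw [h]
      exact Finset.sum_eq_zero fun s hs => by rw [hcon s hs, mul_zero, zero_smul]
    change vecMulVec (xs i₀) (w i₀) = 0 at hY0
    exact (vecMulVec_eq_zero' hY0).elim (hx0 i₀) (hw i₀)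
  obtain ⟨s₁, hs₁, hg₁⟩ := hex
  have hρ₁ : ρ s₁ ≠ 0 := hsupp i₀ s₁ hs₁ hg₁
  have hu' : ∀ i, ∃ u : Fin 2 → k, ∀ y : Fin 2 → k, vecMulVec y u *ᵥ xs i = y := by
    intro i
    obtain ⟨l, hl⟩ := Function.ne_iff.mp (hx0 i)
    refine ⟨Pi.single l (xs i l)⁻¹, fun y => ?_⟩
    rw [vecMulVec_mulVec, single_dotProduct, inv_mul_cancel₀ hl, MulOpposite.op_one, one_smul]
  choose u hu using hu'
  -- the combined relation, for every `y`
  have hcomb : ∀ y : Fin 2 → k,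
      ∑ s ∈ O, (∑ i, a i * (β.f s (vecMulVec y (u i)) * β.g s (Y i))) • β.w s = 0 := by
    intro y
    have h1 : ∑ i, a i • (vecMulVec y (u i) * Y i) = 0 := by
      have h2 : ∀ i, vecMulVec y (u i) * Y i = vecMulVec y (w i) := fun i => by rw [hXYv, hu]
      simp_rw [h2]
      have h3 : ∑ i, a i • vecMulVec y (w i) = vecMulVec y (∑ i, a i • w i) := by
        rw [← DeltaLaw.vecMulVecRight_apply, map_sum]
        refine Finset.sum_congr rfl fun j _ => ?_
        rw [map_smul, DeltaLaw.vecMulVecRight_apply]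
      rw [h3, hrel]
      exact vecMulVec_zero' _
    have h4 : ∑ i, a i • (vecMulVec y (u i) * Y i) =
        ∑ s ∈ O, (∑ i, a i * (β.f s (vecMulVec y (u i)) * β.g s (Y i))) • β.w s := by
      simp_rw [hXY, Finset.smul_sum, smul_smul]
      rw [Finset.sum_comm]
      refine Finset.sum_congr rfl fun s _ => ?_
      rw [Finset.sum_smul]
    rw [← h4, h1]
  have hE : ∀ (y : Fin 2 → k), ∀ s ∈ O,
      (∑ i, a i * (β.f s (vecMulVec y (u i)) * β.g s (Y i))) * ρ s₁ =
        (∑ i, a i * (β.f s₁ (vecMulVec y (u i)) * β.g s₁ (Y i))) * ρ s :=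
    fun y s hs => hF3 _ (hcomb y) s hs s₁ hs₁
  have hsingle : ∀ (y : Fin 2 → k), ∀ s ∈ O, β.g s (Y i₀) ≠ 0 →
      ∑ i, a i * (β.f s (vecMulVec y (u i)) * β.g s (Y i)) = a i₀ * (β.f s (vecMulVec y (u i₀)) * β.g s (Y i₀)) := by
    intro y s hs hg
    rw [Finset.sum_eq_single i₀]
    · intro i _ hi
      rw [hdisj i₀ i (Ne.symm hi) s hs hg, mul_zero, mul_zero]
    · intro h
      exact absurd (Finset.mem_univ i₀) h
  -- a nonzero `y₀` in the kernel of the linear form `y ↦ f_{s₁}(y ⊗ u_{i₀})`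
  obtain ⟨y₀, hy₀ne, hlam0⟩ : ∃ y₀ : Fin 2 → k, y₀ ≠ 0 ∧ β.f s₁ (vecMulVec y₀ (u i₀)) = 0 := by
    by_cases h0 : β.f s₁ (vecMulVec (Pi.single 0 1) (u i₀)) = 0
    · refine ⟨Pi.single 0 1, ?_, h0⟩
      intro h
      have := congr_fun h 0
      simp at this
    · refine ⟨β.f s₁ (vecMulVec (Pi.single 1 1) (u i₀)) • Pi.single 0 1 -
        β.f s₁ (vecMulVec (Pi.single 0 1) (u i₀)) • Pi.single 1 1, ?_, ?_⟩
      · intro h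
        have := congr_fun h 1
        simp at this
        exact h0 this
      · rw [sub_vecMulVec, smul_vecMulVec, smul_vecMulVec, map_sub, map_smul, map_smul, smul_eq_mul, smul_eq_mul]
        ring
  have hprod : ∀ s ∈ O, β.f s (vecMulVec y₀ (u i₀)) * β.g s (Y i₀) = 0 := by
    intro s hs
    by_cases hg : β.g s (Y i₀) = 0
    · rw [hg, mul_zero]
    · have h := hE y₀ s hs
      rw [hsingle y₀ s hs hg, hsingle y₀ s₁ hs₁ hg₁, hlam0, zero_mul, mul_zero, zero_mul] at h
      rcases mul_eq_zero.mp h with h' | h'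
      · exact (mul_eq_zero.mp h').resolve_left (ha i₀)
      · exact absurd h' hρ₁
  have hfin : vecMulVec y₀ (w i₀) = 0 := by
    rw [← hu i₀ y₀, ← hXYv i₀ (vecMulVec y₀ (u i₀)), hXY]
    exact Finset.sum_eq_zero fun s hs => by rw [hprod s hs, zero_smul]
  exact (vecMulVec_eq_zero' hfin).elim hy₀ne (hw i₀)

end NearDeltaLaw

end Summit.MatrixMultiplication.OmegaCensus.SmallFormats
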